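import Summits.QuantumFields.BalabanUV.Beta.GAN24.ColumnResponseOfWardLetters
import Summits.QuantumFields.BalabanUV.Beta.GAN24.DressedVertexFacePush

/-!
# `BalabanUV.Beta.GAN24.VertexFacePushOfWardLetters` — binder row G-an2-4 ∕ (CONV-C), TRANSFER-III («slot the chain», the OWNER gan24-p1's `TRANSFER-III-SIZING.v0_7.md`
# §3(a), second option; R-gan24p1-g46-2): **THE WEIGHTED BOND SUMS OF THE CHAIN-RULE VERTEX AND THE PUSH LAW `hpush` OF A PACKED KERNEL FROM ITS WARD LETTERS
# ALONE** — leaf-06 g54's `DressedVertexFaceBondSum` §2–§4 and MY Part 46 `DressedVertexFacePush` §1–§3 RE-CUT OVER A GENERIC KERNEL `X` WITH DISPLAYED LETTERS, and the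
# instance at the COMB-CHART dressed step `X̃′_j := unitK s_f s_m (GcombSh Lc j)` of row D1's literal of record (III′) (G-an2-4 CRUX TEAM (2), leaf prover `b2b-balaban-gan24-formalise-leaf-02`, gen 78)

NOT IN PRINT; OUR BOOKKEEPING ([folklore] BY NAME over `ColumnResponseOfWardLetters` (this gen), leaf-04's `DressedHalfVertex.hasSum_vertexOfK_bond_site`, leaf-06 g54's generic
§1 (`decays_rowWeight`, `vertexOfK_rowWeight`), MY Part 46's generic §1 (`colM_colWeight`, `vertexOfM_colWeight`, `decays_colWeight`), gan24-leaf-14's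
`MultiplierVertexBondSum.hasSum_vertexOfM_bond(_locStencilFM)`, leaf-04 g62's `FaceWeightedSandwich.emod_mul_eq_iff`, an2's `SecondOrderResponse.vertexFamily_dM ∕ dM_translate` and,
for the instance, an2's (III′) letters `CombChartHColumnWard.colH_ward_GcombSh`, `CombChartWardSockets.colM_GcombSh_ward`, `CombChartStepJets.decays_GcombSh ∕ shiftK_GcombSh`;
0 `def`, 0 cited fact, 0 `def … : Prop`, 0 sorry).  HONEST FRAMING (cell contract, verbatim): «discharging `BetaPertH` makes Bałaban's UV stability UNCONDITIONAL — a real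
constructive-QFT result; it is NOT the continuum limit and NOT the Clay problem.»  HONEST DEPENDENCY (verbatim): «continuum YM on T⁴ ⇐ BetaPertH ∧ nine spine estimates
(0/9 proved); BetaPertH ⇐ (D1) ∧ (D4) ∧ CAP+tail; G-an2-4 gates asym, D1 and NE2/3/4.»

WHY.  Row (C)sym's supplier side (T6-STEP: the forcing's face reads are antisymmetric-pair forms) enters road-P2's adapter `hBF` through Part 49 `pairFormLS_of_threeWords`, whose
hypotheses `hpush` ∕ `hD` ∕ `hDt` on `D := dM X̃ Lc S M` were discharged at (E), `X̃ = unitK s_f s_m (coDressKBmAt ρ Lc (KInvStep Lc j))`, by MY Part 46 over leaf-06's weighted bond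
sum and road-P2's column responses — all of which read `X̃` through four letters only: decay (DG), block translation (TG), the `ℋ`-column Ward law (W-H), the multiplier-column
Ward law (W-M).  This file proves them ONCE over the letters; §4 instantiates at the comb-chart dressed step of the literal OF RECORD (III′).  (E) is NOT restated.

WHAT (generic `d`, `Lc ≥ 1`; `X : MKer (d+1) (Fib d)` with (DG) `Decays X C m`, `m > 0`; constant `cH : ℝ`; (W-H) `∀ y κ u, Σ_μ (colH X Lc μ (y − e_μ) κ u − colH X Lc μ y κ u) =
cH·gaugeWt Lc y κ u`; (W-M) `∀ y ρ w, Σ_μ (colM X Lc μ (y − e_μ) ρ w − colM X Lc μ y ρ w) = 0`; (TG) `∀ t, shiftK (−(Lc•t)) X = X`):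
* §1 FIELD LEGS: `hasSum_col_coordWeight_of_ward`, **`hasSum_vertexOfK_coordWeight_of_ward`** (`HasSum (u′ ↦ f(u′_ν)·vertexOfK X Lc S ν u′ x z a b) (cH·Σ'_t 𝟙[t_ν % Lc =
  Lc−1]·f(⌊t_ν∕Lc⌋)·S ν t x z a b)`, bounded `f`, local `S`), **`tsum_faceBond_vertexOfK_of_ward`** (period-`N` exit-face weight ⟹ the deeper class `𝟙[t_ν % (Lc·N) = Lc·N − 1]`).
* §2 MULTIPLIER LEGS: `hasSum_colM_colWeight_zero_of_ward`, **`hasSum_coordWeight_vertexOfM_of_ward`** (`HasSum (u ↦ f(u_μ)·vertexOfM X Lc M μ u x z a b) 0`), `…_slice_of_ward`.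
* §3 THE PUSH LAW **`tsum_faceBond_dM_of_ward`**: `Σ'_u 𝟙[u_μ % P = P−1]·dM X Lc S M μ u x z a b = cH·Σ'_t 𝟙[t_μ % (Lc·P) = Lc·P−1]·S μ t x z a b` (`P ≥ 1`) = Part 45's `hpush`;
  `exists_vertexFamily_dM_of_decays` (`hD`), `dM_translate_coarse_of_shiftK` (`hDt`, deep period `Lc·P`).
* §4 THE (III′) INSTANCE `X̃′_j` (ANY units, every `j`; no in-block-root hypothesis — `GcombSh` is rooted at `ctr`; the units letters are `ColumnResponseOfWardLetters`
  §3): **`tsum_faceBond_dM_combStep`** (constant `(s_f s_m)·cH_j`, `cH_j = (stepScale d Lc j·Lc^{d+1})⁻¹`), `hasSum_vertexOfK_combStep_coordWeight`,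
  `tsum_faceBond_vertexOfK_combStep`, `hasSum_coordWeight_vertexOfM_combStep(_slice)`, `exists_vertexFamily_dM_combStep`, `dM_combStep_translate_coarse` — the (III′) twins of
  Part 46 ∕ leaf-06 §3–§4, token for token with `GcombSh Lc j` for `coDressKBmAt ρ Lc (KInvStep Lc j)`.
Asserts NO value of any table; discharges NOTHING of (C) ∕ (C)sym ∕ `hstep` ∕ `hSrc` ∕ `hSrcX` ∕ (Q-L) ∕ `(hS, hSall)` ∕ `(hW, hWall)` at (E) or (III′); the value ledger at `GcombSh` is
NOT touched (engine first, R-gan24p1-g46-2); NEVER «G-an2-4 closed» as (CONV-C); NOT D1, NOT `BetaPertH`, NOT continuum, NOT Clay.  2026-08-25; no existing file touched.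
-/

noncomputable section

open Finset
open scoped BigOperators
open Literature.MathematicalPhysics.QuantumFieldTheory
open Literature.MathematicalPhysics.QuantumFieldTheory.Balaban1983to89
open Literature.MathematicalPhysics.QuantumFieldTheory.Balaban1983to89.Beta
open B12Sec2to5 (l1 l1_nonneg)
open B6BondElimination (unitVec)
open ExpKernelCalculus (Site MKer Decays VertexFamily shiftK)
open OneStepResolventKernel (Fib LocStencil decays_mono)
open BalabanStepJets (locStencil_mono)
open AveragingContours (blk)
open AxialProjector (blk_zsmul)
open OneStepKernelFamily (colH vertexOfK)
open SecondOrderResponse (colM vertexOfM dM dM_apply vertexFamily_dM dM_translate LocStencilFM)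
open Summit.QuantumFields.BalabanUV.Beta.BorderedHessian (stepScale)
open Summit.QuantumFields.BalabanUV.Beta.KernelWardRelative (gaugeWt)
open Summit.QuantumFields.BalabanUV.Beta.HessKerDressedUnits (unitK decays_unitK)
open Summit.QuantumFields.BalabanUV.Beta.GAN24.CoarseGaugeSourceResponse (summable_bdd_mul)
open Summit.QuantumFields.BalabanUV.Beta.GAN24.MultiplierVertexBondSum (hasSum_vertexOfM_bond hasSum_vertexOfM_bond_locStencilFM)
open Summit.QuantumFields.BalabanUV.Beta.GAN24.DressedHalfVertex (hasSum_vertexOfK_bond_site)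
open Summit.QuantumFields.BalabanUV.Beta.GAN24.DressedVertexFaceBondSum (decays_rowWeight vertexOfK_rowWeight)
open Summit.QuantumFields.BalabanUV.Beta.GAN24.DressedVertexFacePush (colM_colWeight vertexOfM_colWeight decays_colWeight)
open Summit.QuantumFields.BalabanUV.Beta.GAN24.ColumnResponseOfWardLetters (summable_colH_of_decays summable_colM_of_decays tsum_coord_colH_of_ward
  tsum_coord_colM_of_ward colH_ward_unitK colM_ward_unitK shiftK_unitK_of_shiftK)
open Summit.QuantumFields.BalabanUV.Beta.CombChartStepJets (GcombSh decays_GcombSh shiftK_GcombSh)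
open Summit.QuantumFields.BalabanUV.Beta.CombChartHColumnWard (colH_ward_GcombSh)
open Summit.QuantumFields.BalabanUV.Beta.CombChartWardSockets (colM_GcombSh_ward)

namespace Summit.QuantumFields.BalabanUV.Beta.GAN24.VertexFacePushOfWardLetters

variable {d : ℕ} {Lc : ℕ} [NeZero Lc]

section Ward

variable {X : MKer (d + 1) (Fib d)} {C m cH : ℝ}

/-! ## §1 Field legs: the weighted column charge and the weighted bond sum of the chain-rule vertex -/

/-- [folklore] **THE SINGLE-COORDINATE-WEIGHTED COLUMN CHARGE FROM THE LETTERS** (bounded `f`, every fibre `g`, fine row `w`):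
`HasSum (z′ ↦ K_f w (Lc•z′) g (inr ν)) (g = inl κ ↦ 𝟙[κ = ν ∧ w_ν % Lc = Lc−1]·cH·f(⌊w_ν∕Lc⌋); g = inr m ↦ 0)`, `K_f` = leaf-06's row-weighted kernel of `X`
(`ColumnResponseOfWardLetters.tsum_coord_colH_of_ward`; the multiplier rows carry the weight `0`). -/
theorem hasSum_col_coordWeight_of_ward (hX : Decays X C m) (hm : 0 < m)
    (hHw : ∀ (y : Site (d + 1)) (κ : Fin (d + 1)) (u : Site (d + 1)),
      ∑ μ, (colH X Lc μ (y - unitVec μ) κ u - colH X Lc μ y κ u) = cH * gaugeWt Lc y κ u)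
    (ν : Fin (d + 1)) (f : ℤ → ℝ) {B : ℝ} (hf : ∀ s, |f s| ≤ B) (g : Fib d) (w : Site (d + 1)) :
    HasSum (fun z' : Site (d + 1) => Sum.elim (fun _ : Fin (d + 1) => f (blk Lc ((Lc : ℤ) • z') ν)) (fun _ : Fin (d + 1) => (0 : ℝ)) g *
        X w ((Lc : ℤ) • z') g (Sum.inr ν))
      (Sum.elim (fun κ => if κ = ν ∧ w ν % (Lc : ℤ) = (Lc : ℤ) - 1 then cH * f (blk Lc w ν) else 0) (fun _ => (0 : ℝ)) g) := by
  classical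
  have hLc : 1 ≤ Lc := Nat.one_le_iff_ne_zero.2 (NeZero.ne Lc)
  rcases g with κ | m'
  · simp only [Sum.elim_inl, blk_zsmul hLc]
    have hs : Summable fun z' : Site (d + 1) => f (z' ν) * colH X Lc ν z' κ w :=
      summable_bdd_mul (summable_colH_of_decays hX hm ν κ w) (fun z' => hf (z' ν))
    have h := hs.hasSum
    rw [tsum_coord_colH_of_ward (summable_colH_of_decays hX hm) hHw ν f hf κ w] at h
    have hv : cH * (if κ = ν ∧ w ν % (Lc : ℤ) = (Lc : ℤ) - 1 then f (blk Lc w ν) else 0) =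
        (if κ = ν ∧ w ν % (Lc : ℤ) = (Lc : ℤ) - 1 then cH * f (blk Lc w ν) else 0) := by
      split_ifs <;> ring
    rw [hv] at h
    exact h.congr_fun fun z' => rfl
  · simp only [Sum.elim_inr, zero_mul]
    exact hasSum_zero

/-- NOT IN PRINT; OUR BOOKKEEPING.  **THE SINGLE-COORDINATE-WEIGHTED BOND SUM OF THE CHAIN-RULE VERTEX FROM THE LETTERS** (bounded `f`, local `S` at a positive rate, any legs):
`HasSum (u′ ↦ f(u′_ν)·vertexOfK X Lc S ν u′ x z a b) (cH·Σ'_t 𝟙[t_ν % Lc = Lc−1]·f(⌊t_ν∕Lc⌋)·S ν t x z a b)` — leaf-04's `hasSum_vertexOfK_bond_site` at leaf-06's row-weighted kernel,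
column charges by §1; the generic form of leaf-06 g54's `hasSum_vertexOfK_dressedStep_coordWeight`. -/
theorem hasSum_vertexOfK_coordWeight_of_ward (hX : Decays X C m) (hm : 0 < m)
    (hHw : ∀ (y : Site (d + 1)) (κ : Fin (d + 1)) (u : Site (d + 1)),
      ∑ μ, (colH X Lc μ (y - unitVec μ) κ u - colH X Lc μ y κ u) = cH * gaugeWt Lc y κ u)
    (ν : Fin (d + 1)) (f : ℤ → ℝ) {B : ℝ} (hf : ∀ s, |f s| ≤ B)
    {S : Fin (d + 1) → Site (d + 1) → MKer (d + 1) (Fib d)} {Cs δs : ℝ} (hS : LocStencil S Cs δs) (hδs : 0 < δs)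
    (x z : Site (d + 1)) (a b : Fib d) :
    HasSum (fun u' : Site (d + 1) => f (u' ν) * vertexOfK X Lc S ν u' x z a b)
      (cH * ∑' t : Site (d + 1), (if t ν % (Lc : ℤ) = (Lc : ℤ) - 1 then f (t ν / (Lc : ℤ)) * S ν t x z a b else 0)) := by
  classical
  have hLc : 1 ≤ Lc := Nat.one_le_iff_ne_zero.2 (NeZero.ne Lc)
  have hC : 0 ≤ C := hX.nonneg (Sum.inl 0)
  have hCs : 0 ≤ Cs := (hS 0 0).nonneg (Sum.inl 0)
  set m' : ℝ := min m δs with hm'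
  have hm0 : 0 < m' := lt_min hm hδs
  have hXm : Decays X C m' := decays_mono hX hC le_rfl (min_le_left _ _)
  have hKf := decays_rowWeight (Lc := Lc) (f := f) ν hXm hf
  have hSm : LocStencil S Cs m' := locStencil_mono hS hCs (min_le_right _ _)
  have h := hasSum_vertexOfK_bond_site (N := Lc)
    (K := fun w z g b => Sum.elim (fun _ : Fin (d + 1) => f (blk Lc z ν)) (fun _ : Fin (d + 1) => (0 : ℝ)) g * X w z g b) hKf hm0 ν
    (ρR := fun g w => Sum.elim (fun κ => if κ = ν ∧ w ν % (Lc : ℤ) = (Lc : ℤ) - 1 then cH * f (blk Lc w ν) else 0) (fun _ => (0 : ℝ)) g)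
    (fun g w => hasSum_col_coordWeight_of_ward (d := d) hX hm hHw ν f hf g w) hSm x z a b
  -- the value: only the colour `κ = ν` survives
  have hv : (∑ κ : Fin (d + 1), ∑' t : Site (d + 1), Sum.elim (fun κ : Fin (d + 1) => if κ = ν ∧ t ν % (Lc : ℤ) = (Lc : ℤ) - 1 then
      cH * f (blk Lc t ν) else 0) (fun _ : Fin (d + 1) => (0 : ℝ)) (Sum.inl κ : Fib d) * S κ t x z a b) =
      cH * ∑' t : Site (d + 1), (if t ν % (Lc : ℤ) = (Lc : ℤ) - 1 then f (t ν / (Lc : ℤ)) * S ν t x z a b else 0) := by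
    simp only [Sum.elim_inl]
    rw [Finset.sum_eq_single ν]
    · rw [← tsum_mul_left]
      refine tsum_congr fun t => ?_
      simp only [true_and, blk]
      split_ifs <;> ring
    · intro κ _ hκ
      simp [hκ]
    · intro hν
      exact absurd (Finset.mem_univ ν) hν
  rw [hv] at h
  refine h.congr_fun fun u' => ?_
  exact (vertexOfK_rowWeight (Lc := Lc) ν hLc f S u' x z a b).symm

/-- NOT IN PRINT; OUR BOOKKEEPING.  **THE PERIOD-`N` EXIT-FACE BOND SUM OF THE CHAIN-RULE VERTEX READS THE TABLE ON THE DEEPER EXIT CLASS, FROM THE LETTERS**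
(`1 ≤ N`, local `S`, any legs): `Σ'_{u′} 𝟙[u′_ν % N = N−1]·vertexOfK X Lc S ν u′ x z a b = cH·Σ'_t 𝟙[t_ν % (Lc·N) = Lc·N − 1]·S ν t x z a b`
(§1 at `f = χ^N`, then leaf-04 g62's `FaceWeightedSandwich.emod_mul_eq_iff`); the generic form of leaf-06 g54's `tsum_faceBond_vertexOfK_dressedStep`. -/
theorem tsum_faceBond_vertexOfK_of_ward (hX : Decays X C m) (hm : 0 < m)
    (hHw : ∀ (y : Site (d + 1)) (κ : Fin (d + 1)) (u : Site (d + 1)),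
      ∑ μ, (colH X Lc μ (y - unitVec μ) κ u - colH X Lc μ y κ u) = cH * gaugeWt Lc y κ u)
    (ν : Fin (d + 1)) {N : ℕ} (hN : 1 ≤ N)
    {S : Fin (d + 1) → Site (d + 1) → MKer (d + 1) (Fib d)} {Cs δs : ℝ} (hS : LocStencil S Cs δs) (hδs : 0 < δs)
    (x z : Site (d + 1)) (a b : Fib d) :
    ∑' u' : Site (d + 1), (if u' ν % (N : ℤ) = (N : ℤ) - 1 then (1 : ℝ) else 0) * vertexOfK X Lc S ν u' x z a b =
      cH * ∑' t : Site (d + 1), (if t ν % ((Lc : ℤ) * (N : ℤ)) = (Lc : ℤ) * (N : ℤ) - 1 then S ν t x z a b else 0) := by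
  classical
  have hLc : 1 ≤ Lc := Nat.one_le_iff_ne_zero.2 (NeZero.ne Lc)
  have hf : ∀ s : ℤ, |(fun s : ℤ => if s % (N : ℤ) = (N : ℤ) - 1 then (1 : ℝ) else 0) s| ≤ 1 := fun s => by
    simp only; split_ifs <;> simp
  have h := (hasSum_vertexOfK_coordWeight_of_ward hX hm hHw ν (fun s : ℤ => if s % (N : ℤ) = (N : ℤ) - 1 then (1 : ℝ) else 0)
    hf hS hδs x z a b).tsum_eq
  rw [h]
  congr 1
  refine tsum_congr fun t => ?_
  have hLc0 : (0 : ℤ) < Lc := by exact_mod_cast hLc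
  have hN0 : (0 : ℤ) < N := by exact_mod_cast hN
  have key := FaceWeightedSandwich.emod_mul_eq_iff hLc0 hN0 (t ν)
  by_cases h1 : t ν % (Lc : ℤ) = (Lc : ℤ) - 1
  · by_cases h2 : t ν / (Lc : ℤ) % (N : ℤ) = (N : ℤ) - 1
    · rw [if_pos h1, if_pos h2, if_pos (key.2 ⟨h1, h2⟩), one_mul]
    · rw [if_pos h1, if_neg h2, if_neg (fun h => h2 (key.1 h).2), zero_mul]
  · rw [if_neg h1, if_neg (fun h => h1 (key.1 h).1)]

/-! ## §2 Multiplier legs: the multiplier vertex dies under a single-coordinate weight -/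

/-- [folklore] **ZERO WEIGHTED BOND MASSES OF THE DIRECTION-LOCKED COLUMN-WEIGHTED KERNEL, FROM THE LETTER (W-M)**: in the direction `μ` by
`ColumnResponseOfWardLetters.tsum_coord_colM_of_ward`, in the other directions the weight is `0` (MY Part 46 `colM_colWeight`). -/
theorem hasSum_colM_colWeight_zero_of_ward (hX : Decays X C m) (hm : 0 < m)
    (hMw : ∀ (y : Site (d + 1)) (ρ : Fin (d + 1)) (w : Site (d + 1)), ∑ μ, (colM X Lc μ (y - unitVec μ) ρ w - colM X Lc μ y ρ w) = 0)
    (μ : Fin (d + 1)) (f : ℤ → ℝ) {B : ℝ} (hf : ∀ s, |f s| ≤ B) (μ' ρ : Fin (d + 1)) (w : Site (d + 1)) :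
    HasSum (fun y : Site (d + 1) =>
      colM (fun x z a b => Sum.elim (fun _ : Fin (d + 1) => (0 : ℝ)) (fun μ'' : Fin (d + 1) => if μ'' = μ then f (blk Lc z μ) else 0) b *
        X x z a b) Lc μ' y ρ w) 0 := by
  have hLc : 1 ≤ Lc := Nat.one_le_iff_ne_zero.2 (NeZero.ne Lc)
  by_cases hμ : μ' = μ
  · subst hμ
    have e : ∀ y : Site (d + 1),
        colM (fun x z a b => Sum.elim (fun _ : Fin (d + 1) => (0 : ℝ)) (fun μ'' : Fin (d + 1) => if μ'' = μ' then f (blk Lc z μ') else 0) b *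
            X x z a b) Lc μ' y ρ w = f (y μ') * colM X Lc μ' y ρ w := by
      intro y
      rw [colM_colWeight μ' hLc, if_pos rfl]
    have hs : Summable fun y : Site (d + 1) => f (y μ') * colM X Lc μ' y ρ w :=
      summable_bdd_mul (summable_colM_of_decays hX hm μ' ρ w) (fun y => hf (y μ'))
    have h := hs.hasSum
    rw [tsum_coord_colM_of_ward (summable_colM_of_decays hX hm) hMw μ' f hf ρ w] at h
    exact h.congr_fun fun y => e y
  · have e : ∀ y : Site (d + 1),
        colM (fun x z a b => Sum.elim (fun _ : Fin (d + 1) => (0 : ℝ)) (fun μ'' : Fin (d + 1) => if μ'' = μ then f (blk Lc z μ) else 0) b *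
            X x z a b) Lc μ' y ρ w = 0 := by
      intro y
      rw [colM_colWeight μ hLc, if_neg hμ, zero_mul]
    simp_rw [e]
    exact hasSum_zero

/-- NOT IN PRINT; OUR BOOKKEEPING.  **THE MULTIPLIER VERTEX CONTRIBUTES NOTHING TO A SINGLE-COORDINATE-WEIGHTED BOND SUM, FROM THE LETTERS** (bounded `f`, direction `μ`,
`VertexFamily M Lc CM δM`, entrywise): `HasSum (u ↦ f(u_μ)·vertexOfM X Lc M μ u x z a b) 0` — gan24-leaf-14's `hasSum_vertexOfM_bond` at the column-weighted kernel;
the generic form of MY Part 46 `hasSum_coordWeight_vertexOfM_dressedStep`. -/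
theorem hasSum_coordWeight_vertexOfM_of_ward (hX : Decays X C m) (hm : 0 < m)
    (hMw : ∀ (y : Site (d + 1)) (ρ : Fin (d + 1)) (w : Site (d + 1)), ∑ μ, (colM X Lc μ (y - unitVec μ) ρ w - colM X Lc μ y ρ w) = 0)
    (μ : Fin (d + 1)) (f : ℤ → ℝ) {B : ℝ} (hf : ∀ s, |f s| ≤ B)
    {M : Fin (d + 1) → Site (d + 1) → MKer (d + 1) (Fib d)} {CM δM : ℝ} (hM : VertexFamily M Lc CM δM) (hδM : 0 < δM)
    (x z : Site (d + 1)) (a b : Fib d) :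
    HasSum (fun u : Site (d + 1) => f (u μ) * vertexOfM X Lc M μ u x z a b) 0 := by
  have hLc : 1 ≤ Lc := Nat.one_le_iff_ne_zero.2 (NeZero.ne Lc)
  have hKf := decays_colWeight (Lc := Lc) (f := f) μ hX hf
  have h := hasSum_vertexOfM_bond (N := Lc) hKf hm (fun μ' ρ w => hasSum_colM_colWeight_zero_of_ward hX hm hMw μ f hf μ' ρ w) hM hδM μ x z a b
  refine h.congr_fun fun u => ?_
  exact (vertexOfM_colWeight μ hLc f _ M u x z a b).symm

/-- NOT IN PRINT; OUR BOOKKEEPING.  **THE SAME FOR THE SLICES `M₂ κ u` OF A MIXED TABLE** (`LocStencilFM Lc M₂ C₂ δ₂`); generic form of MY Part 46 `…_dressedStep_slice`. -/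
theorem hasSum_coordWeight_vertexOfM_slice_of_ward (hX : Decays X C m) (hm : 0 < m)
    (hMw : ∀ (y : Site (d + 1)) (ρ : Fin (d + 1)) (w : Site (d + 1)), ∑ μ, (colM X Lc μ (y - unitVec μ) ρ w - colM X Lc μ y ρ w) = 0)
    (μ : Fin (d + 1)) (f : ℤ → ℝ) {B : ℝ} (hf : ∀ s, |f s| ≤ B)
    {M₂ : Fin (d + 1) → Site (d + 1) → Fin (d + 1) → Site (d + 1) → MKer (d + 1) (Fib d)} {C₂ δ₂ : ℝ}
    (hM₂ : LocStencilFM Lc M₂ C₂ δ₂) (hδ₂ : 0 < δ₂) (κ : Fin (d + 1)) (u : Site (d + 1)) (x z : Site (d + 1)) (a b : Fib d) :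
    HasSum (fun y : Site (d + 1) => f (y μ) * vertexOfM X Lc (M₂ κ u) μ y x z a b) 0 := by
  have hLc : 1 ≤ Lc := Nat.one_le_iff_ne_zero.2 (NeZero.ne Lc)
  have hKf := decays_colWeight (Lc := Lc) (f := f) μ hX hf
  have h := hasSum_vertexOfM_bond_locStencilFM (N := Lc) hKf hm
    (fun μ' ρ w => hasSum_colM_colWeight_zero_of_ward hX hm hMw μ f hf μ' ρ w) hM₂ hδ₂ κ u μ x z a b
  refine h.congr_fun fun y => ?_
  exact (vertexOfM_colWeight μ hLc f _ (M₂ κ u) y x z a b).symm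

/-! ## §3 The push law for the full vertex `dM X Lc S M` -/

/-- NOT IN PRINT; OUR BOOKKEEPING.  **THE EXIT-FACE BOND SUM OF `dM` AT COARSE PERIOD `P` READS THE FINE TABLE ON THE EXIT CLASS OF PERIOD `Lc·P`, FROM THE LETTERS**
— Part 45's `hpush` for `D := dM X Lc S M`: `Σ'_u 𝟙[u_μ % P = P−1]·dM X Lc S M μ u x z a b = cH·Σ'_t 𝟙[t_μ % (Lc·P) = Lc·P−1]·S μ t x z a b` (§1 for the field vertex
⨾ §2 for the multiplier vertex); the generic form of MY Part 46 `tsum_faceBond_dM_dressedStep`. -/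
theorem tsum_faceBond_dM_of_ward (hX : Decays X C m) (hm : 0 < m)
    (hHw : ∀ (y : Site (d + 1)) (κ : Fin (d + 1)) (u : Site (d + 1)),
      ∑ μ, (colH X Lc μ (y - unitVec μ) κ u - colH X Lc μ y κ u) = cH * gaugeWt Lc y κ u)
    (hMw : ∀ (y : Site (d + 1)) (ρ : Fin (d + 1)) (w : Site (d + 1)), ∑ μ, (colM X Lc μ (y - unitVec μ) ρ w - colM X Lc μ y ρ w) = 0)
    (μ : Fin (d + 1)) {P : ℕ} (hP : 1 ≤ P)
    {S : Fin (d + 1) → Site (d + 1) → MKer (d + 1) (Fib d)} {Cs δs : ℝ} (hS : LocStencil S Cs δs) (hδs : 0 < δs)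
    {M : Fin (d + 1) → Site (d + 1) → MKer (d + 1) (Fib d)} {CM δM : ℝ} (hM : VertexFamily M Lc CM δM) (hδM : 0 < δM)
    (x z : Site (d + 1)) (a b : Fib d) :
    ∑' u : Site (d + 1), (if u μ % (P : ℤ) = (P : ℤ) - 1 then (1 : ℝ) else 0) * dM X Lc S M μ u x z a b
      = cH * ∑' t : Site (d + 1), (if t μ % ((Lc * P : ℕ) : ℤ) = ((Lc * P : ℕ) : ℤ) - 1 then (1 : ℝ) else 0) * S μ t x z a b := by
  classical
  have hLc : 1 ≤ Lc := Nat.one_le_iff_ne_zero.2 (NeZero.ne Lc)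
  have hf : ∀ s : ℤ, |(fun s : ℤ => if s % (P : ℤ) = (P : ℤ) - 1 then (1 : ℝ) else 0) s| ≤ 1 := fun s => by
    simp only; split_ifs <;> simp
  have hK := hasSum_vertexOfK_coordWeight_of_ward hX hm hHw μ (fun s : ℤ => if s % (P : ℤ) = (P : ℤ) - 1 then (1 : ℝ) else 0) hf hS hδs x z a b
  have hMz := hasSum_coordWeight_vertexOfM_of_ward hX hm hMw μ (fun s : ℤ => if s % (P : ℤ) = (P : ℤ) - 1 then (1 : ℝ) else 0) hf hM hδM x z a b
  have hsum := hK.add hMz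
  rw [add_zero] at hsum
  have e : ∀ u : Site (d + 1), (if u μ % (P : ℤ) = (P : ℤ) - 1 then (1 : ℝ) else 0) * dM X Lc S M μ u x z a b
      = (if u μ % (P : ℤ) = (P : ℤ) - 1 then (1 : ℝ) else 0) * vertexOfK X Lc S μ u x z a b +
        (if u μ % (P : ℤ) = (P : ℤ) - 1 then (1 : ℝ) else 0) * vertexOfM X Lc M μ u x z a b := by
    intro u; rw [dM_apply]; ring
  simp_rw [e]
  rw [hsum.tsum_eq]
  congr 1
  refine tsum_congr fun t => ?_
  have hLc0 : (0 : ℤ) < Lc := by exact_mod_cast hLc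
  have hP0 : (0 : ℤ) < P := by exact_mod_cast hP
  have key := FaceWeightedSandwich.emod_mul_eq_iff hLc0 hP0 (t μ)
  push_cast
  by_cases h1 : t μ % (Lc : ℤ) = (Lc : ℤ) - 1
  · by_cases h2 : t μ / (Lc : ℤ) % (P : ℤ) = (P : ℤ) - 1
    · rw [if_pos h1, if_pos h2, if_pos (key.2 ⟨h1, h2⟩)]
    · rw [if_pos h1, if_neg h2, if_neg (fun h => h2 (key.1 h).2)]
  · rw [if_neg h1, if_neg (fun h => h1 (key.1 h).1), zero_mul]

/-- NOT IN PRINT; OUR BOOKKEEPING.  **THE VERTEX `dM X Lc S M` IS A VERTEX FAMILY** for any decaying `X` (an2's `vertexFamily_dM` at the common rate): `∃ CD δ > 0,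
VertexFamily (dM X Lc S M) Lc CD δ` — Part 45's `hD`. -/
theorem exists_vertexFamily_dM_of_decays (hX : Decays X C m) (hm : 0 < m)
    {S : Fin (d + 1) → Site (d + 1) → MKer (d + 1) (Fib d)} {Cs δs : ℝ} (hS : LocStencil S Cs δs) (hδs : 0 < δs)
    {M : Fin (d + 1) → Site (d + 1) → MKer (d + 1) (Fib d)} {CM δM : ℝ} (hM : VertexFamily M Lc CM δM) (hδM : 0 < δM) :
    ∃ CD δ : ℝ, 0 < δ ∧ VertexFamily (dM X Lc S M) Lc CD δ := by
  have hC : 0 ≤ C := hX.nonneg (Sum.inl 0)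
  have hCs : 0 ≤ Cs := (hS 0 0).nonneg (Sum.inl 0)
  have hCM : 0 ≤ CM := (hM 0 0).nonneg (Sum.inl 0)
  set m' : ℝ := min m (min δs δM) with hm'
  have hm0 : 0 < m' := lt_min hm (lt_min hδs hδM)
  have hSm : LocStencil S Cs m' := fun κ u => OneStepResolventKernel.biLoc_mono (hS κ u) hCs ((min_le_right _ _).trans (min_le_left _ _))
  have hMm : VertexFamily M Lc CM m' := fun ρ w => OneStepResolventKernel.biLoc_mono (hM ρ w) hCM ((min_le_right _ _).trans (min_le_right _ _))
  exact ⟨_, m' / 2, half_pos hm0, vertexFamily_dM (N := Lc) hX hC hSm hMm hm0 (min_le_left _ _)⟩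

/-- NOT IN PRINT; OUR BOOKKEEPING.  **COARSE COVARIANCE OF `dM X Lc S M` AT PERIOD `P` FROM THE LETTER (TG)** (jointly `Lc`-covariant `S`, `M` in an2's `dM_translate` shapes):
`dM X Lc S M κ (u + P•s) = shiftK (−((Lc·P)•s)) (dM X Lc S M κ u)` — Part 45's `hDt` with the deep period `Lc·P`. -/
theorem dM_translate_coarse_of_shiftK (hXt : ∀ t : Site (d + 1), shiftK (-((Lc : ℤ) • t)) X = X) (P : ℕ)
    {S : Fin (d + 1) → Site (d + 1) → MKer (d + 1) (Fib d)} {M : Fin (d + 1) → Site (d + 1) → MKer (d + 1) (Fib d)}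
    (hSt : ∀ (κ : Fin (d + 1)) (u t : Site (d + 1)), S κ (u + (Lc : ℤ) • t) = shiftK (-((Lc : ℤ) • t)) (S κ u))
    (hMt : ∀ (ρ : Fin (d + 1)) (w t : Site (d + 1)), M ρ (w + t) = shiftK (-((Lc : ℤ) • t)) (M ρ w))
    (κ : Fin (d + 1)) (u s : Site (d + 1)) :
    dM X Lc S M κ (u + (P : ℤ) • s) = shiftK (-(((Lc * P : ℕ) : ℤ) • s)) (dM X Lc S M κ u) := by
  rw [dM_translate hXt hSt hMt κ u ((P : ℤ) • s)]
  congr 2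
  push_cast
  rw [smul_smul]

end Ward

/-! ## §4 The (III′) instance `X̃′_j = unitK s_f s_m (GcombSh Lc j)` -/

section CombStep

variable (Lc)

/-- NOT IN PRINT; OUR BOOKKEEPING.  **(III′) — THE WEIGHTED BOND SUM OF THE COMB-CHART DRESSED CHAIN-RULE VERTEX** (every `j`, ANY units, bounded `f`, local `S`):
`HasSum (u′ ↦ f(u′_ν)·vertexOfK X̃′_j Lc S ν u′ x z a b) ((s_f s_m)·cH_j·Σ'_t 𝟙[t_ν % Lc = Lc−1]·f(⌊t_ν∕Lc⌋)·S ν t x z a b)`, `X̃′_j = unitK s_f s_m (GcombSh Lc j)` —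
the (III′) twin of leaf-06 g54's `hasSum_vertexOfK_dressedStep_coordWeight`. -/
theorem hasSum_vertexOfK_combStep_coordWeight (sf sm : ℝ) (j : ℕ) (ν : Fin (d + 1)) (f : ℤ → ℝ) {B : ℝ} (hf : ∀ s, |f s| ≤ B)
    {S : Fin (d + 1) → Site (d + 1) → MKer (d + 1) (Fib d)} {Cs δs : ℝ} (hS : LocStencil S Cs δs) (hδs : 0 < δs)
    (x z : Site (d + 1)) (a b : Fib d) :
    HasSum (fun u' : Site (d + 1) => f (u' ν) * vertexOfK (unitK sf sm (GcombSh (d := d) Lc j)) Lc S ν u' x z a b)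
      ((sf * sm * (stepScale d Lc j * (Lc : ℝ) ^ (d + 1))⁻¹) *
        ∑' t : Site (d + 1), (if t ν % (Lc : ℤ) = (Lc : ℤ) - 1 then f (t ν / (Lc : ℤ)) * S ν t x z a b else 0)) := by
  obtain ⟨δ, C, hδ, _, hK⟩ := decays_GcombSh (d := d) Lc j
  exact hasSum_vertexOfK_coordWeight_of_ward (decays_unitK hK) hδ
    (colH_ward_unitK (fun y κ u => colH_ward_GcombSh (d := d) (Lc := Lc) j y κ u) sf sm) ν f hf hS hδs x z a b

/-- NOT IN PRINT; OUR BOOKKEEPING.  **(III′) — THE PERIOD-`N` EXIT-FACE BOND SUM OF THE COMB-CHART DRESSED VERTEX READS THE DEEPER CLASS** (`1 ≤ N`):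
`Σ'_{u′} 𝟙[u′_ν % N = N−1]·vertexOfK X̃′_j Lc S ν u′ x z a b = (s_f s_m)·cH_j·Σ'_t 𝟙[t_ν % (Lc·N) = Lc·N − 1]·S ν t x z a b` — the (III′) twin of leaf-06 g54's
`tsum_faceBond_vertexOfK_dressedStep`. -/
theorem tsum_faceBond_vertexOfK_combStep (sf sm : ℝ) (j : ℕ) (ν : Fin (d + 1)) {N : ℕ} (hN : 1 ≤ N)
    {S : Fin (d + 1) → Site (d + 1) → MKer (d + 1) (Fib d)} {Cs δs : ℝ} (hS : LocStencil S Cs δs) (hδs : 0 < δs)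
    (x z : Site (d + 1)) (a b : Fib d) :
    ∑' u' : Site (d + 1), (if u' ν % (N : ℤ) = (N : ℤ) - 1 then (1 : ℝ) else 0) *
        vertexOfK (unitK sf sm (GcombSh (d := d) Lc j)) Lc S ν u' x z a b =
      (sf * sm * (stepScale d Lc j * (Lc : ℝ) ^ (d + 1))⁻¹) *
        ∑' t : Site (d + 1), (if t ν % ((Lc : ℤ) * (N : ℤ)) = (Lc : ℤ) * (N : ℤ) - 1 then S ν t x z a b else 0) := by
  obtain ⟨δ, C, hδ, _, hK⟩ := decays_GcombSh (d := d) Lc j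
  exact tsum_faceBond_vertexOfK_of_ward (decays_unitK hK) hδ
    (colH_ward_unitK (fun y κ u => colH_ward_GcombSh (d := d) (Lc := Lc) j y κ u) sf sm) ν hN hS hδs x z a b

/-- NOT IN PRINT; OUR BOOKKEEPING.  **(III′) — THE MULTIPLIER VERTEX OF THE COMB-CHART DRESSED STEP CONTRIBUTES NOTHING TO A SINGLE-COORDINATE-WEIGHTED BOND SUM**
(every `j`, ANY units, bounded `f`, `VertexFamily M`): `HasSum (u ↦ f(u_μ)·vertexOfM X̃′_j Lc M μ u x z a b) 0` — the (III′) twin of MY Part 46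
`hasSum_coordWeight_vertexOfM_dressedStep`. -/
theorem hasSum_coordWeight_vertexOfM_combStep (sf sm : ℝ) (j : ℕ) (μ : Fin (d + 1)) (f : ℤ → ℝ) {B : ℝ} (hf : ∀ s, |f s| ≤ B)
    {M : Fin (d + 1) → Site (d + 1) → MKer (d + 1) (Fib d)} {CM δM : ℝ} (hM : VertexFamily M Lc CM δM) (hδM : 0 < δM)
    (x z : Site (d + 1)) (a b : Fib d) :
    HasSum (fun u : Site (d + 1) => f (u μ) * vertexOfM (unitK sf sm (GcombSh (d := d) Lc j)) Lc M μ u x z a b) 0 := by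
  obtain ⟨δ, C, hδ, _, hK⟩ := decays_GcombSh (d := d) Lc j
  exact hasSum_coordWeight_vertexOfM_of_ward (decays_unitK hK) hδ
    (colM_ward_unitK (fun y ρ w => colM_GcombSh_ward (d := d) (Lc := Lc) j y ρ w) sf sm) μ f hf hM hδM x z a b

/-- NOT IN PRINT; OUR BOOKKEEPING.  **(III′) — THE SAME FOR THE SLICES OF A MIXED TABLE** — the (III′) twin of MY Part 46 `hasSum_coordWeight_vertexOfM_dressedStep_slice`. -/
theorem hasSum_coordWeight_vertexOfM_combStep_slice (sf sm : ℝ) (j : ℕ) (μ : Fin (d + 1)) (f : ℤ → ℝ) {B : ℝ} (hf : ∀ s, |f s| ≤ B)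
    {M₂ : Fin (d + 1) → Site (d + 1) → Fin (d + 1) → Site (d + 1) → MKer (d + 1) (Fib d)} {C₂ δ₂ : ℝ}
    (hM₂ : LocStencilFM Lc M₂ C₂ δ₂) (hδ₂ : 0 < δ₂) (κ : Fin (d + 1)) (u : Site (d + 1)) (x z : Site (d + 1)) (a b : Fib d) :
    HasSum (fun y : Site (d + 1) => f (y μ) * vertexOfM (unitK sf sm (GcombSh (d := d) Lc j)) Lc (M₂ κ u) μ y x z a b) 0 := by
  obtain ⟨δ, C, hδ, _, hK⟩ := decays_GcombSh (d := d) Lc j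
  exact hasSum_coordWeight_vertexOfM_slice_of_ward (decays_unitK hK) hδ
    (colM_ward_unitK (fun y ρ w => colM_GcombSh_ward (d := d) (Lc := Lc) j y ρ w) sf sm) μ f hf hM₂ hδ₂ κ u x z a b

/-- NOT IN PRINT; OUR BOOKKEEPING.  **(III′) — THE PUSH LAW FOR THE COMB-CHART DRESSED VERTEX** (every `j`, ANY units, every coarse period `P ≥ 1`, local `S`, `VertexFamily M`):
`Σ'_u 𝟙[u_μ % P = P−1]·dM X̃′_j Lc S M μ u x z a b = (s_f s_m)·cH_j·Σ'_t 𝟙[t_μ % (Lc·P) = Lc·P−1]·S μ t x z a b`, `cH_j = (stepScale d Lc j·Lc^{d+1})⁻¹` — Part 45's `hpush`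
at (III′); the (III′) twin of MY Part 46 `tsum_faceBond_dM_dressedStep`, SAME constant. -/
theorem tsum_faceBond_dM_combStep (sf sm : ℝ) (j : ℕ) (μ : Fin (d + 1)) {P : ℕ} (hP : 1 ≤ P)
    {S : Fin (d + 1) → Site (d + 1) → MKer (d + 1) (Fib d)} {Cs δs : ℝ} (hS : LocStencil S Cs δs) (hδs : 0 < δs)
    {M : Fin (d + 1) → Site (d + 1) → MKer (d + 1) (Fib d)} {CM δM : ℝ} (hM : VertexFamily M Lc CM δM) (hδM : 0 < δM)
    (x z : Site (d + 1)) (a b : Fib d) :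
    ∑' u : Site (d + 1), (if u μ % (P : ℤ) = (P : ℤ) - 1 then (1 : ℝ) else 0) *
        dM (unitK sf sm (GcombSh (d := d) Lc j)) Lc S M μ u x z a b
      = (sf * sm * (stepScale d Lc j * (Lc : ℝ) ^ (d + 1))⁻¹) *
        ∑' t : Site (d + 1), (if t μ % ((Lc * P : ℕ) : ℤ) = ((Lc * P : ℕ) : ℤ) - 1 then (1 : ℝ) else 0) * S μ t x z a b := by
  obtain ⟨δ, C, hδ, _, hK⟩ := decays_GcombSh (d := d) Lc j
  exact tsum_faceBond_dM_of_ward (decays_unitK hK) hδ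
    (colH_ward_unitK (fun y κ u => colH_ward_GcombSh (d := d) (Lc := Lc) j y κ u) sf sm)
    (colM_ward_unitK (fun y ρ w => colM_GcombSh_ward (d := d) (Lc := Lc) j y ρ w) sf sm) μ hP hS hδs hM hδM x z a b

/-- NOT IN PRINT; OUR BOOKKEEPING.  **(III′) — THE COMB-CHART DRESSED VERTEX IS A VERTEX FAMILY** (Part 45's `hD` at (III′)). -/
theorem exists_vertexFamily_dM_combStep (sf sm : ℝ) (j : ℕ)
    {S : Fin (d + 1) → Site (d + 1) → MKer (d + 1) (Fib d)} {Cs δs : ℝ} (hS : LocStencil S Cs δs) (hδs : 0 < δs)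
    {M : Fin (d + 1) → Site (d + 1) → MKer (d + 1) (Fib d)} {CM δM : ℝ} (hM : VertexFamily M Lc CM δM) (hδM : 0 < δM) :
    ∃ CD δ : ℝ, 0 < δ ∧ VertexFamily (dM (unitK sf sm (GcombSh (d := d) Lc j)) Lc S M) Lc CD δ := by
  obtain ⟨δ, C, hδ, _, hK⟩ := decays_GcombSh (d := d) Lc j
  exact exists_vertexFamily_dM_of_decays (decays_unitK hK) hδ hS hδs hM hδM

/-- NOT IN PRINT; OUR BOOKKEEPING.  **(III′) — COARSE COVARIANCE OF THE COMB-CHART DRESSED VERTEX AT PERIOD `P`** (jointly `Lc`-covariant `S`, `M`):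
`dM X̃′_j Lc S M κ (u + P•s) = shiftK (−((Lc·P)•s)) (dM X̃′_j Lc S M κ u)` (Part 45's `hDt` at (III′); `shiftK_GcombSh`). -/
theorem dM_combStep_translate_coarse (sf sm : ℝ) (j : ℕ) (P : ℕ)
    {S : Fin (d + 1) → Site (d + 1) → MKer (d + 1) (Fib d)} {M : Fin (d + 1) → Site (d + 1) → MKer (d + 1) (Fib d)}
    (hSt : ∀ (κ : Fin (d + 1)) (u t : Site (d + 1)), S κ (u + (Lc : ℤ) • t) = shiftK (-((Lc : ℤ) • t)) (S κ u))
    (hMt : ∀ (ρ : Fin (d + 1)) (w t : Site (d + 1)), M ρ (w + t) = shiftK (-((Lc : ℤ) • t)) (M ρ w))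
    (κ : Fin (d + 1)) (u s : Site (d + 1)) :
    dM (unitK sf sm (GcombSh (d := d) Lc j)) Lc S M κ (u + (P : ℤ) • s)
      = shiftK (-(((Lc * P : ℕ) : ℤ) • s)) (dM (unitK sf sm (GcombSh (d := d) Lc j)) Lc S M κ u) :=
  dM_translate_coarse_of_shiftK (shiftK_unitK_of_shiftK (fun t => shiftK_GcombSh (d := d) Lc j t) sf sm) P hSt hMt κ u s

end CombStep

end Summit.QuantumFields.BalabanUV.Beta.GAN24.VertexFacePushOfWardLetters

end
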